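import Mathlib
import HarnessLib
import Summits.HubbardSuperconductivity.HubbardSuperconductivity.Theorems.DeformationLadderLadderThesisRigidityReduction
import Summits.HubbardSuperconductivity.HubbardSuperconductivity.Theorems.AposterioriCapRgSsbToEvenTorusLroDoubleCommBound
import Summits.HubbardSuperconductivity.HubbardSuperconductivity.Theorems.ThermalWedgeTwApproximatingHamiltonianLocality

/-!
# Route `DeformationLadder` — crux `LowEnergyRigidity` (stmt-HubbardSuperconductivity-1892),
# crux idea `heavy-condensate-fibration`: the IMS fibration in the order parameter

Composition half of the crux idea (companion of `…LowEnergyRigidityCondensateHeavy.lean`, which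
proves that `Π_L = L⁻⁴ Δᴴ Δ` is a heavy variable, `‖[Π_L,[Π_L,H_L]]‖ = O(L⁻²)`):
* `hcf_two_nsmul_ims_identity` / `hcf_re_expect_ims` — the EXACT IMS identity (card's first lemma
  `ims_identity`): `2H = 2(K₁HK₁ + K₂HK₂) + [K₁,[K₁,H]] + [K₂,[K₂,H]]` for `K₁² + K₂² = 1`.
* `hcf_fibration_lower_bound`, `hcf_fibration_rigidity` — the FIBRATION PRINCIPLE: a Hermitian
  cutoff pair preserving the sector `S`, with `K₁S ⊆ T` (`T` gapped by `κ` above the sector bound),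
  `a₀K₂² ≤ P` on `S` (Markov) and IMS budget `ε` forces `Re⟨φ,Pφ⟩ ≥ a₀(κ-ε-κ')/κ` for every unit
  `φ ∈ S` within `κ'` of the bottom — the `→` direction of the card's `compressionGap_iff_rigidity`
  with the cutoff pair as data (its construction by smooth functional calculus is the companion
  `…SpectralTransfer` / `SmoothCutoffBound`).
* `hcf_lowEnergyRigidity_of_compressionGap` — the crux BY NAME from a compression gap at one
  `(U,δ)` plus cutoff pairs, `(κ',a) = (κ/4, a₀/2)`.
* `hcf_compressionGap_of_lowEnergyRigidity` — the easy direction `←` (incl. the card's kernel gap).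
* `hcf_norm_condensate_commutator_le` — contrast: `‖[Π_L,H_L]‖` is `O(1)`, the size of the window.

References: IMS localisation (Sigal 1982; Cycon–Froese–Kirsch–Simon Thm 3.2) in the number-like
variable of Lewin–Nam–Serfaty–Solovej, CPAM 68 (2015) 413, Prop. 6.1 (arXiv:1211.2778).
-/

namespace Summit.HubbardSuperconductivity.HubbardSuperconductivity.Theorems

set_option linter.dupNamespace false

open Literature.MathematicalPhysics.QuantumLattice Literature.Probability.LatticeModels Matrix
open scoped Matrix.Norms.L2Operator ComplexOrder

section IMS

variable {R : Type*} [Ring R]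

/-- **The exact IMS identity** (card `heavy-condensate-fibration`, first lemma), integral form valid
in any ring: if `K₁ K₁ + K₂ K₂ = 1` then
`2H = 2(K₁ H K₁ + K₂ H K₂) + ([K₁,[K₁,H]] + [K₂,[K₂,H]])`, where `[K,[K,H]] = K(KH - HK) - (KH - HK)K
= K²H - 2KHK + HK²`. No commutation of `K₁` with `K₂` is used. Sigal 1982 / Cycon–Froese–Kirsch–Simon
Thm 3.2 (IMS localisation formula). [folklore] -/
theorem hcf_two_nsmul_ims_identity (H K₁ K₂ : R) (hK : K₁ * K₁ + K₂ * K₂ = 1) :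
    2 • H = 2 • (K₁ * H * K₁ + K₂ * H * K₂) +
      ((K₁ * (K₁ * H - H * K₁) - (K₁ * H - H * K₁) * K₁) +
        (K₂ * (K₂ * H - H * K₂) - (K₂ * H - H * K₂) * K₂)) := by
  have h : (K₁ * (K₁ * H - H * K₁) - (K₁ * H - H * K₁) * K₁) +
      (K₂ * (K₂ * H - H * K₂) - (K₂ * H - H * K₂) * K₂) =
      (K₁ * K₁ + K₂ * K₂) * H + H * (K₁ * K₁ + K₂ * K₂) - 2 • (K₁ * H * K₁ + K₂ * H * K₂) := by
    noncomm_ring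
  rw [h, hK, one_mul, mul_one]
  abel

variable {n : Type*} [Fintype n] [DecidableEq n]

omit [DecidableEq n] in
/-- `⟨A x, y⟩ = ⟨x, Aᴴ y⟩` for the `star`-dot product. [folklore] -/
theorem hcf_star_mulVec_dotProduct (A : Matrix n n ℂ) (x y : n → ℂ) :
    star (A *ᵥ x) ⬝ᵥ y = star x ⬝ᵥ (Aᴴ *ᵥ y) := by
  rw [star_mulVec, ← dotProduct_mulVec]

omit [DecidableEq n] in
/-- For Hermitian `K`: `⟨φ, (K H K) φ⟩ = ⟨Kφ, H Kφ⟩`. [folklore] -/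
theorem hcf_expect_conj_eq (H K : Matrix n n ℂ) (hK : Kᴴ = K) (φ : n → ℂ) :
    star φ ⬝ᵥ ((K * H * K) *ᵥ φ) = star (K *ᵥ φ) ⬝ᵥ (H *ᵥ (K *ᵥ φ)) := by
  rw [hcf_star_mulVec_dotProduct, hK, ← mulVec_mulVec, ← mulVec_mulVec]

/-- For Hermitian `K₁, K₂` with `K₁² + K₂² = 1`: `‖K₁φ‖² + ‖K₂φ‖² = ‖φ‖²`. [folklore] -/
theorem hcf_norm_sq_add_norm_sq (K₁ K₂ : Matrix n n ℂ) (hK₁ : K₁ᴴ = K₁) (hK₂ : K₂ᴴ = K₂)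
    (hK : K₁ * K₁ + K₂ * K₂ = 1) (φ : n → ℂ) :
    star (K₁ *ᵥ φ) ⬝ᵥ (K₁ *ᵥ φ) + star (K₂ *ᵥ φ) ⬝ᵥ (K₂ *ᵥ φ) = star φ ⬝ᵥ φ := by
  rw [hcf_star_mulVec_dotProduct, hcf_star_mulVec_dotProduct, hK₁, hK₂, mulVec_mulVec,
    mulVec_mulVec, ← dotProduct_add, ← add_mulVec, hK, one_mulVec]

/-- **The IMS identity in quadratic form**: for Hermitian `K₁, K₂` with `K₁² + K₂² = 1`,
`Re⟨φ,Hφ⟩ = Re⟨K₁φ,HK₁φ⟩ + Re⟨K₂φ,HK₂φ⟩ + ½ Re⟨φ, ([K₁,[K₁,H]] + [K₂,[K₂,H]]) φ⟩`. [folklore] -/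
theorem hcf_re_expect_ims (H K₁ K₂ : Matrix n n ℂ) (hK₁ : K₁ᴴ = K₁) (hK₂ : K₂ᴴ = K₂)
    (hK : K₁ * K₁ + K₂ * K₂ = 1) (φ : n → ℂ) :
    (star φ ⬝ᵥ (H *ᵥ φ)).re =
      (star (K₁ *ᵥ φ) ⬝ᵥ (H *ᵥ (K₁ *ᵥ φ))).re + (star (K₂ *ᵥ φ) ⬝ᵥ (H *ᵥ (K₂ *ᵥ φ))).re +
        (1 / 2 : ℝ) * (star φ ⬝ᵥ (((K₁ * (K₁ * H - H * K₁) - (K₁ * H - H * K₁) * K₁) +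
          (K₂ * (K₂ * H - H * K₂) - (K₂ * H - H * K₂) * K₂)) *ᵥ φ)).re := by
  have h := hcf_two_nsmul_ims_identity H K₁ K₂ hK
  rw [two_nsmul, two_nsmul] at h
  have h2 := congrArg (fun M : Matrix n n ℂ => (star φ ⬝ᵥ (M *ᵥ φ)).re) h
  simp only [add_mulVec, dotProduct_add, Complex.add_re] at h2
  rw [hcf_expect_conj_eq H K₁ hK₁, hcf_expect_conj_eq H K₂ hK₂] at h2
  rw [add_mulVec, dotProduct_add, Complex.add_re]
  linarith

end IMS

/-! ### The fibration principle (abstract, finite-dimensional) -/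

section Fibration

variable {n : Type*} [Fintype n] [DecidableEq n]

/-- **The fibration lower bound.** Hermitian `K₁, K₂` with `K₁² + K₂² = 1` preserve the sector `S`
and `K₁S ⊆ T`; `Re⟨ψ,Hψ⟩ ≥ E₀‖ψ‖²` on `S`, `≥ (E₀+κ)‖χ‖²` on `S ⊓ T` (`κ ≥ 0`), `a₀‖K₂ψ‖² ≤ Re⟨ψ,Pψ⟩`
on `S` (`a₀ > 0`) and IMS budget `|Re⟨ψ,([K₁,[K₁,H]]+[K₂,[K₂,H]])ψ⟩| ≤ 2ε‖ψ‖²` on `S`. Then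
`(E₀ + κ - ε)‖φ‖² - (κ/a₀)Re⟨φ,Pφ⟩ ≤ Re⟨φ,Hφ⟩` for `φ ∈ S` (IMS identity + the two fibre bounds +
`‖K₁φ‖² = ‖φ‖² - ‖K₂φ‖²`). Lewin–Nam–Serfaty–Solovej 2015, Prop. 6.1 (mechanism). [folklore] -/
theorem hcf_fibration_lower_bound (H P K₁ K₂ : Matrix n n ℂ) (hK₁ : K₁ᴴ = K₁) (hK₂ : K₂ᴴ = K₂)
    (hK : K₁ * K₁ + K₂ * K₂ = 1) (S T : Submodule ℂ (n → ℂ))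
    (hS₁ : ∀ ψ ∈ S, K₁ *ᵥ ψ ∈ S) (hS₂ : ∀ ψ ∈ S, K₂ *ᵥ ψ ∈ S) (hT : ∀ ψ ∈ S, K₁ *ᵥ ψ ∈ T)
    {E₀ κ ε a₀ : ℝ} (hκ : 0 ≤ κ) (ha₀ : 0 < a₀)
    (hE₀ : ∀ ψ ∈ S, E₀ * (star ψ ⬝ᵥ ψ).re ≤ (star ψ ⬝ᵥ (H *ᵥ ψ)).re)
    (hgap : ∀ χ ∈ S, χ ∈ T → (E₀ + κ) * (star χ ⬝ᵥ χ).re ≤ (star χ ⬝ᵥ (H *ᵥ χ)).re)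
    (hP : ∀ ψ ∈ S, a₀ * (star (K₂ *ᵥ ψ) ⬝ᵥ (K₂ *ᵥ ψ)).re ≤ (star ψ ⬝ᵥ (P *ᵥ ψ)).re)
    (hDC : ∀ ψ ∈ S, |(star ψ ⬝ᵥ (((K₁ * (K₁ * H - H * K₁) - (K₁ * H - H * K₁) * K₁) +
        (K₂ * (K₂ * H - H * K₂) - (K₂ * H - H * K₂) * K₂)) *ᵥ ψ)).re| ≤ 2 * ε * (star ψ ⬝ᵥ ψ).re)
    (φ : n → ℂ) (hφ : φ ∈ S) :
    (E₀ + κ - ε) * (star φ ⬝ᵥ φ).re - κ / a₀ * (star φ ⬝ᵥ (P *ᵥ φ)).re ≤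
      (star φ ⬝ᵥ (H *ᵥ φ)).re := by
  have hims := hcf_re_expect_ims H K₁ K₂ hK₁ hK₂ hK φ
  have hnorm := congrArg Complex.re (hcf_norm_sq_add_norm_sq K₁ K₂ hK₁ hK₂ hK φ)
  rw [Complex.add_re] at hnorm
  have h1 := hgap (K₁ *ᵥ φ) (hS₁ φ hφ) (hT φ hφ)
  have h2 := hE₀ (K₂ *ᵥ φ) (hS₂ φ hφ)
  have h3 := hP φ hφ
  have h4 := (abs_le.1 (hDC φ hφ)).1
  -- name the real quantities
  set x₁ := (star (K₁ *ᵥ φ) ⬝ᵥ (K₁ *ᵥ φ)).re with hx₁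
  set x₂ := (star (K₂ *ᵥ φ) ⬝ᵥ (K₂ *ᵥ φ)).re with hx₂
  set nφ := (star φ ⬝ᵥ φ).re with hnφ
  set p := (star φ ⬝ᵥ (P *ᵥ φ)).re with hp
  -- `κ ‖K₂φ‖² ≤ (κ/a₀) Re⟨φ,Pφ⟩`
  have h5 : κ * x₂ ≤ κ / a₀ * p := by
    rw [div_mul_eq_mul_div, le_div_iff₀ ha₀]
    calc κ * x₂ * a₀ = κ * (a₀ * x₂) := by ring
      _ ≤ κ * p := mul_le_mul_of_nonneg_left h3 hκ
  have hE : E₀ * x₁ + E₀ * x₂ = E₀ * nφ := by rw [← mul_add, hnorm]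
  have hκ2 : κ * x₁ + κ * x₂ = κ * nφ := by rw [← mul_add, hnorm]
  have h1' : E₀ * x₁ + κ * x₁ ≤ (star (K₁ *ᵥ φ) ⬝ᵥ (H *ᵥ (K₁ *ᵥ φ))).re := by
    rw [← add_mul]; exact h1
  have hgoal : (E₀ + κ - ε) * nφ - κ / a₀ * p = E₀ * nφ + κ * nφ - ε * nφ - κ / a₀ * p := by ring
  rw [hgoal]
  linarith

/-- **The fibration principle, rigidity form**: under the hypotheses of `hcf_fibration_lower_bound`
with `κ > 0`, a unit `φ ∈ S` with `Re⟨φ,Hφ⟩ ≤ E₀ + κ'` has `Re⟨φ,Pφ⟩ ≥ a₀(κ - ε - κ')/κ` — the `→`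
direction of the card's `compressionGap_iff_rigidity`, the cutoff pair being data. [folklore] -/
theorem hcf_fibration_rigidity (H P K₁ K₂ : Matrix n n ℂ) (hK₁ : K₁ᴴ = K₁) (hK₂ : K₂ᴴ = K₂)
    (hK : K₁ * K₁ + K₂ * K₂ = 1) (S T : Submodule ℂ (n → ℂ))
    (hS₁ : ∀ ψ ∈ S, K₁ *ᵥ ψ ∈ S) (hS₂ : ∀ ψ ∈ S, K₂ *ᵥ ψ ∈ S) (hT : ∀ ψ ∈ S, K₁ *ᵥ ψ ∈ T)
    {E₀ κ κ' ε a₀ : ℝ} (hκ : 0 < κ) (ha₀ : 0 < a₀)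
    (hE₀ : ∀ ψ ∈ S, E₀ * (star ψ ⬝ᵥ ψ).re ≤ (star ψ ⬝ᵥ (H *ᵥ ψ)).re)
    (hgap : ∀ χ ∈ S, χ ∈ T → (E₀ + κ) * (star χ ⬝ᵥ χ).re ≤ (star χ ⬝ᵥ (H *ᵥ χ)).re)
    (hP : ∀ ψ ∈ S, a₀ * (star (K₂ *ᵥ ψ) ⬝ᵥ (K₂ *ᵥ ψ)).re ≤ (star ψ ⬝ᵥ (P *ᵥ ψ)).re)
    (hDC : ∀ ψ ∈ S, |(star ψ ⬝ᵥ (((K₁ * (K₁ * H - H * K₁) - (K₁ * H - H * K₁) * K₁) +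
        (K₂ * (K₂ * H - H * K₂) - (K₂ * H - H * K₂) * K₂)) *ᵥ ψ)).re| ≤ 2 * ε * (star ψ ⬝ᵥ ψ).re)
    (φ : n → ℂ) (hφ : φ ∈ S) (hφ1 : star φ ⬝ᵥ φ = 1)
    (hlow : (star φ ⬝ᵥ (H *ᵥ φ)).re ≤ E₀ + κ') :
    a₀ * (κ - ε - κ') / κ ≤ (star φ ⬝ᵥ (P *ᵥ φ)).re := by
  have h := hcf_fibration_lower_bound H P K₁ K₂ hK₁ hK₂ hK S T hS₁ hS₂ hT hκ.le ha₀ hE₀ hgap hP hDC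
    φ hφ
  rw [hφ1, Complex.one_re, mul_one] at h
  rw [div_le_iff₀ hκ]
  have h' : κ - ε - κ' ≤ κ / a₀ * (star φ ⬝ᵥ (P *ᵥ φ)).re := by linarith
  have h'' := mul_le_mul_of_nonneg_left h' ha₀.le
  calc a₀ * (κ - ε - κ') ≤ a₀ * (κ / a₀ * (star φ ⬝ᵥ (P *ᵥ φ)).re) := h''
    _ = (star φ ⬝ᵥ (P *ᵥ φ)).re * κ := by field_simp

omit [DecidableEq n] in
/-- The sector energy bounds every (not necessarily normalised) vector of the sector:
`minEnergyOn H S · ‖ψ‖² ≤ Re⟨ψ,Hψ⟩` for `ψ ∈ S`. [folklore] -/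
theorem hcf_minEnergyOn_mul_le (H : Matrix n n ℂ) (S : Submodule ℂ (n → ℂ)) {ψ : n → ℂ}
    (hψ : ψ ∈ S) : H.minEnergyOn S * (star ψ ⬝ᵥ ψ).re ≤ (star ψ ⬝ᵥ (H *ᵥ ψ)).re := by
  by_cases h0 : ψ = 0
  · subst h0
    simp
  obtain ⟨c, hc, hc1⟩ := Literature.MathematicalPhysics.QuantumLattice.exists_smul_unit h0
  have hle := minEnergyOn_le_re_rayleigh H S (S.smul_mem c hψ) hc1
  have hcc : (0 : ℝ) < (starRingEnd ℂ c * c).re := by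
    rw [Complex.conj_mul', ← Complex.ofReal_pow, Complex.ofReal_re]
    exact pow_pos (norm_pos_iff.2 hc) 2
  have hunit : (starRingEnd ℂ c * c) * (star ψ ⬝ᵥ ψ) = 1 := by
    rw [← hc1, star_smul, smul_dotProduct, dotProduct_smul, smul_smul, smul_eq_mul, Complex.star_def]
  have hray : star (c • ψ) ⬝ᵥ (H *ᵥ (c • ψ)) = (starRingEnd ℂ c * c) * (star ψ ⬝ᵥ (H *ᵥ ψ)) := by
    rw [mulVec_smul, star_smul, smul_dotProduct, dotProduct_smul, smul_smul, smul_eq_mul,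
      Complex.star_def]
  rw [hray] at hle
  -- `r := conj c * c` is a positive real with `r ‖ψ‖² = 1`
  have hr_im : (starRingEnd ℂ c * c).im = 0 := by
    rw [Complex.conj_mul', ← Complex.ofReal_pow, Complex.ofReal_im]
  have hre1 : (starRingEnd ℂ c * c).re * (star ψ ⬝ᵥ ψ).re = 1 := by
    have := congrArg Complex.re hunit
    rw [Complex.mul_re, hr_im, zero_mul, sub_zero, Complex.one_re] at this
    exact this
  have hre2 : ((starRingEnd ℂ c * c) * (star ψ ⬝ᵥ (H *ᵥ ψ))).re =
      (starRingEnd ℂ c * c).re * (star ψ ⬝ᵥ (H *ᵥ ψ)).re := by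
    rw [Complex.mul_re, hr_im, zero_mul, sub_zero]
  rw [hre2] at hle
  -- divide by `r`
  have hψpos : 0 < (star ψ ⬝ᵥ ψ).re := by
    have h := dotProduct_star_self_pos_iff.2 h0
    exact (Complex.pos_iff.1 h).1
  have key : H.minEnergyOn S ≤ (star ψ ⬝ᵥ (H *ᵥ ψ)).re / (star ψ ⬝ᵥ ψ).re := by
    have hr : (starRingEnd ℂ c * c).re = 1 / (star ψ ⬝ᵥ ψ).re := by
      field_simp
      linarith [hre1]
    rw [hr] at hle
    simpa [one_div, inv_mul_eq_div] using hle
  rwa [le_div_iff₀ hψpos] at key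

end Fibration

/-! ### The crux by name from a compression gap and a cutoff pair -/

section Crux

open Summit.HubbardSuperconductivity.HubbardSuperconductivity.Theses.DeformationLadder

/-- **`LowEnergyRigidity` from a compression gap** (card `heavy-condensate-fibration`, composition
`CompressionGapAt → LowEnergyRigidity` with the smooth cutoff pair as data): at one `(U,δ)`, with
`H_L = hubbardTorus 2 L 1 U`, `S_L = szSector N_L 0`, `Π_L = L⁻⁴ΔᴴΔ`, if for all large even `L` there
are a subspace `T_L` with `minEnergyOn H_L (S_L ⊓ T_L) ≥ minEnergyOn H_L S_L + κ` and a Hermitian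
cutoff pair `K₁² + K₂² = 1` preserving `S_L` with `K₁S_L ⊆ T_L`, `a₀‖K₂ψ‖² ≤ Re⟨ψ,Π_Lψ⟩` and IMS
budget `≤ (κ/2)‖ψ‖²` on `S_L`, then `LowEnergyRigidity` holds with `(κ',a) = (κ/4, a₀/2)`. [folklore] -/
theorem hcf_lowEnergyRigidity_of_compressionGap {U : ℝ} (hU : 0 < U) {δ : ℝ}
    (hδ : δ ∈ Set.Ioo (0 : ℝ) (1 / 2)) {κ a₀ : ℝ} (hκ : 0 < κ) (ha₀ : 0 < a₀) (L₀ : ℕ)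
    (h : ∀ (L : ℕ) [NeZero L], L₀ ≤ L → Even L →
      ∃ (T : Submodule ℂ (Fock (Orb (FermionTorus 2 L))))
        (K₁ K₂ : Matrix (Finset (Orb (FermionTorus 2 L))) (Finset (Orb (FermionTorus 2 L))) ℂ),
        (hubbardTorus 2 L 1 U).minEnergyOn (szSector (2 * ⌊(1 - δ) * (L : ℝ) ^ 2 / 2⌋₊) 0) + κ ≤
            (hubbardTorus 2 L 1 U).minEnergyOn (szSector (2 * ⌊(1 - δ) * (L : ℝ) ^ 2 / 2⌋₊) 0 ⊓ T) ∧
          K₁ᴴ = K₁ ∧ K₂ᴴ = K₂ ∧ K₁ * K₁ + K₂ * K₂ = 1 ∧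
          (∀ ψ ∈ szSector (2 * ⌊(1 - δ) * (L : ℝ) ^ 2 / 2⌋₊) 0,
              K₁ *ᵥ ψ ∈ szSector (2 * ⌊(1 - δ) * (L : ℝ) ^ 2 / 2⌋₊) 0) ∧
          (∀ ψ ∈ szSector (2 * ⌊(1 - δ) * (L : ℝ) ^ 2 / 2⌋₊) 0,
              K₂ *ᵥ ψ ∈ szSector (2 * ⌊(1 - δ) * (L : ℝ) ^ 2 / 2⌋₊) 0) ∧
          (∀ ψ ∈ szSector (2 * ⌊(1 - δ) * (L : ℝ) ^ 2 / 2⌋₊) 0, K₁ *ᵥ ψ ∈ T) ∧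
          (∀ ψ ∈ szSector (2 * ⌊(1 - δ) * (L : ℝ) ^ 2 / 2⌋₊) 0,
              a₀ * (star (K₂ *ᵥ ψ) ⬝ᵥ (K₂ *ᵥ ψ)).re ≤
                (star ψ ⬝ᵥ ((((1 : ℂ) / ((L : ℂ) ^ 4)) •
                  ((pairField dWaveFormFactor L)ᴴ * pairField dWaveFormFactor L)) *ᵥ ψ)).re) ∧
          (∀ ψ ∈ szSector (2 * ⌊(1 - δ) * (L : ℝ) ^ 2 / 2⌋₊) 0,
              |(star ψ ⬝ᵥ (((K₁ * (K₁ * hubbardTorus 2 L 1 U - hubbardTorus 2 L 1 U * K₁) -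
                    (K₁ * hubbardTorus 2 L 1 U - hubbardTorus 2 L 1 U * K₁) * K₁) +
                  (K₂ * (K₂ * hubbardTorus 2 L 1 U - hubbardTorus 2 L 1 U * K₂) -
                    (K₂ * hubbardTorus 2 L 1 U - hubbardTorus 2 L 1 U * K₂) * K₂)) *ᵥ ψ)).re| ≤
                2 * (κ / 4) * (star ψ ⬝ᵥ ψ).re)) :
    LowEnergyRigidity := by
  refine ⟨U, hU, δ, hδ, κ / 4, by positivity, a₀ / 2, by positivity, L₀, ?_⟩
  intro L _ hL hev φ hφS hφ1 hlow
  obtain ⟨T, K₁, K₂, hgap, hK₁, hK₂, hKK, hS₁, hS₂, hT, hP, hDC⟩ := h L hL hev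
  set N : ℕ := 2 * ⌊(1 - δ) * (L : ℝ) ^ 2 / 2⌋₊ with hN
  set Hm := hubbardTorus 2 L 1 U with hHm
  set S : Submodule ℂ (Fock (Orb (FermionTorus 2 L))) := szSector N 0 with hS_def
  set P := ((1 : ℂ) / ((L : ℂ) ^ 4)) • ((pairField dWaveFormFactor L)ᴴ * pairField dWaveFormFactor L)
    with hP_def
  set E₀ := Hm.minEnergyOn S with hE₀
  have hE₀le : ∀ ψ ∈ S, E₀ * (star ψ ⬝ᵥ ψ).re ≤ (star ψ ⬝ᵥ (Hm *ᵥ ψ)).re := fun ψ hψ =>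
    hcf_minEnergyOn_mul_le Hm S hψ
  have hgap' : ∀ χ ∈ S, χ ∈ T → (E₀ + κ) * (star χ ⬝ᵥ χ).re ≤ (star χ ⬝ᵥ (Hm *ᵥ χ)).re := by
    intro χ hχS hχT
    have h1 := hcf_minEnergyOn_mul_le Hm (S ⊓ T) (Submodule.mem_inf.2 ⟨hχS, hχT⟩)
    have hnn : 0 ≤ (star χ ⬝ᵥ χ).re := (Complex.nonneg_iff.1 (dotProduct_star_self_nonneg _)).1
    exact (mul_le_mul_of_nonneg_right hgap hnn).trans h1
  have key := hcf_fibration_rigidity Hm P K₁ K₂ hK₁ hK₂ hKK S T hS₁ hS₂ hT (κ' := κ / 4) hκ ha₀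
    hE₀le hgap' hP hDC φ hφS hφ1 hlow
  -- `Re⟨φ, Π_L φ⟩ = Re⟨φ, ΔᴴΔ φ⟩ / L⁴`
  have hPexp : (star φ ⬝ᵥ (P *ᵥ φ)).re =
      (expect ((pairField dWaveFormFactor L)ᴴ * pairField dWaveFormFactor L) φ).re / (L : ℝ) ^ 4 := by
    have hc : (1 : ℂ) / ((L : ℂ) ^ 4) = ((1 / (L : ℝ) ^ 4 : ℝ) : ℂ) := by push_cast; ring
    simp only [hP_def, expect]
    rw [hc, smul_mulVec, dotProduct_smul, smul_eq_mul, Complex.re_ofReal_mul]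
    ring
  rw [hPexp] at key
  have hk : a₀ * (κ - κ / 4 - κ / 4) / κ = a₀ / 2 := by
    field_simp
    ring
  rw [hk] at key
  exact key

end Crux

/-! ### The easy direction: rigidity ⇒ compression gap -/

section Converse

variable {n : Type*} [Fintype n] [DecidableEq n]

omit [DecidableEq n] in
/-- **Rigidity ⇒ compression gap** (abstract `←` of the card's `compressionGap_iff_rigidity`): if
every unit `φ ∈ S` with `Re⟨φ,Hφ⟩ ≤ E₀ + κ` has `Re⟨φ,Pφ⟩ ≥ a`, then `E₀ + κ ≤ minEnergyOn H (S ⊓ T)`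
for every `T` whose unit vectors in `S` have `Re⟨φ,Pφ⟩ < a` (condensate-poor subspaces, `ker Δ` — the
card's KERNEL GAP), provided `S ⊓ T` contains a unit vector. [folklore] -/
theorem hcf_le_minEnergyOn_inf_of_rigidity (H P : Matrix n n ℂ) (S T : Submodule ℂ (n → ℂ))
    {E₀ κ a : ℝ}
    (hrig : ∀ φ ∈ S, star φ ⬝ᵥ φ = 1 → (star φ ⬝ᵥ (H *ᵥ φ)).re ≤ E₀ + κ → a ≤ (star φ ⬝ᵥ (P *ᵥ φ)).re)
    (hT : ∀ φ ∈ S, φ ∈ T → star φ ⬝ᵥ φ = 1 → (star φ ⬝ᵥ (P *ᵥ φ)).re < a)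
    (hne : ∃ φ ∈ S ⊓ T, star φ ⬝ᵥ φ = 1) :
    E₀ + κ ≤ H.minEnergyOn (S ⊓ T) := by
  obtain ⟨φ₀, hφ₀, hφ₀1⟩ := hne
  refine le_csInf ⟨_, φ₀, hφ₀, hφ₀1, rfl⟩ ?_
  rintro E ⟨φ, hφ, hφ1, rfl⟩
  obtain ⟨hφS, hφT⟩ := Submodule.mem_inf.1 hφ
  by_contra hlt
  exact absurd (hrig φ hφS hφ1 (not_le.1 hlt).le) (not_le.2 (hT φ hφS hφT hφ1))

open Summit.HubbardSuperconductivity.HubbardSuperconductivity.Theses.DeformationLadder in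
/-- **`LowEnergyRigidity` ⇒ compression gaps at its point** (`←` of `compressionGap_iff_rigidity`
and the card's item 5(i), the kernel gap): at the crux's `(U,δ,κ,a)`, for all large even `L` and
every subspace `T` on whose unit sector vectors the LRO density `Re⟨ΔᴴΔ⟩/L⁴` stays below `a`,
`minEnergyOn H_L S_L + κ ≤ minEnergyOn H_L (S_L ⊓ T)` (if `S_L ⊓ T` has a unit vector). [folklore] -/
theorem hcf_compressionGap_of_lowEnergyRigidity (h : LowEnergyRigidity) :
    ∃ U : ℝ, 0 < U ∧ ∃ δ ∈ Set.Ioo (0 : ℝ) (1 / 2), ∃ κ : ℝ, 0 < κ ∧ ∃ a : ℝ, 0 < a ∧ ∃ L₀ : ℕ,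
      ∀ (L : ℕ) [NeZero L], L₀ ≤ L → Even L →
        ∀ T : Submodule ℂ (Fock (Orb (FermionTorus 2 L))),
          (∀ φ ∈ szSector (2 * ⌊(1 - δ) * (L : ℝ) ^ 2 / 2⌋₊) 0, φ ∈ T → star φ ⬝ᵥ φ = 1 →
              (expect ((pairField dWaveFormFactor L)ᴴ * pairField dWaveFormFactor L) φ).re /
                  (L : ℝ) ^ 4 < a) →
          (∃ φ ∈ szSector (2 * ⌊(1 - δ) * (L : ℝ) ^ 2 / 2⌋₊) 0 ⊓ T, star φ ⬝ᵥ φ = 1) →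
            (hubbardTorus 2 L 1 U).minEnergyOn (szSector (2 * ⌊(1 - δ) * (L : ℝ) ^ 2 / 2⌋₊) 0) + κ ≤
              (hubbardTorus 2 L 1 U).minEnergyOn (szSector (2 * ⌊(1 - δ) * (L : ℝ) ^ 2 / 2⌋₊) 0 ⊓ T) := by
  obtain ⟨U, hU, δ, hδ, κ, hκ, a, ha, L₀, hL⟩ := h
  refine ⟨U, hU, δ, hδ, κ, hκ, a, ha, L₀, fun L _ hL0 hev T hT hne => ?_⟩
  set P := ((1 : ℂ) / ((L : ℂ) ^ 4)) • ((pairField dWaveFormFactor L)ᴴ * pairField dWaveFormFactor L)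
    with hP_def
  have hPexp : ∀ φ : Fock (Orb (FermionTorus 2 L)), (star φ ⬝ᵥ (P *ᵥ φ)).re =
      (expect ((pairField dWaveFormFactor L)ᴴ * pairField dWaveFormFactor L) φ).re / (L : ℝ) ^ 4 := by
    intro φ
    have hc : (1 : ℂ) / ((L : ℂ) ^ 4) = ((1 / (L : ℝ) ^ 4 : ℝ) : ℂ) := by push_cast; ring
    simp only [hP_def, expect]
    rw [hc, smul_mulVec, dotProduct_smul, smul_eq_mul, Complex.re_ofReal_mul]
    ring
  refine hcf_le_minEnergyOn_inf_of_rigidity (hubbardTorus 2 L 1 U) P _ T (a := a) ?_ ?_ hne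
  · intro φ hφS hφ1 hlow
    rw [hPexp]
    exact hL L hL0 hev φ hφS hφ1 hlow
  · intro φ hφS hφT hφ1
    rw [hPexp]
    exact hT φ hφS hφT hφ1

end Converse

/-! ### For contrast: the first commutator is only `O(1)` -/

section FirstCommutator

variable (g : Site 2 → ℝ) (L : ℕ) [NeZero L]

/-- **`‖[Π_L, H]‖ = O(1)`**: for `Π_L = L⁻⁴ΔᴴΔ` (`Δ = pairField g L`), `H = hubbardTorusWith 2 L t U μ`,
`‖Π_L H - H Π_L‖ ≤ 180 K² (2|t|+|U|+2|μ|)`, `K = 2Σ_e|g e/√2|`, uniformly in `L` (`[ΔᴴΔ,H] =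
Δᴴ[Δ,H] - [H,Δᴴ]Δ`, two `O(L²)` factors) — the order of the energy window itself, which is why only
the DOUBLE commutator (`hcf_condensateIsHeavy`, `O(L⁻²)`) makes the fibration lossless. [folklore] -/
theorem hcf_norm_condensate_commutator_le (t U μ : ℝ) [inst : DecidableEq (FermionTorus 2 L)] :
    ‖(((1 : ℂ) / ((L : ℂ) ^ 4)) • ((pairField g L)ᴴ * pairField g L)) * hubbardTorusWith 2 L t U μ -
        hubbardTorusWith 2 L t U μ * (((1 : ℂ) / ((L : ℂ) ^ 4)) • ((pairField g L)ᴴ * pairField g L))‖ ≤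
      180 * (2 * ∑ e ∈ insert (0 : Site 2) unitSteps, |g e / Real.sqrt 2|) ^ 2 *
        (2 * |t| + |U| + 2 * |μ|) := by
  set K : ℝ := 2 * ∑ e ∈ insert (0 : Site 2) unitSteps, |g e / Real.sqrt 2| with hK_def
  set J : ℝ := 2 * |t| + |U| + 2 * |μ| with hJ_def
  set A := pairField g L with hA_def
  set Hm := hubbardTorusWith 2 L t U μ with hHm_def
  have hK0 : 0 ≤ K := by positivity
  have hJ0 : 0 ≤ J := by positivity
  have hHerm : Hmᴴ = Hm := (isHermitian_hubbardTorusWith L t U μ).eq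
  have hnA : ‖A‖ ≤ K * (L : ℝ) ^ 2 := norm_pairField_le g L
  have hnB : ‖Aᴴ‖ ≤ K * (L : ℝ) ^ 2 := by rw [l2_opNorm_conjTranspose]; exact hnA
  have hnD : ‖A * Hm - Hm * A‖ ≤ 90 * J * K * (L : ℝ) ^ 2 := by
    have h := twAhm_norm_comm_hubbardTorusWith_pairField_le L t U μ g
    rw [← norm_neg, neg_sub]
    refine h.trans (le_of_eq ?_)
    simp only [hJ_def, hK_def]
    ring
  have hnE : ‖Hm * Aᴴ - Aᴴ * Hm‖ ≤ 90 * J * K * (L : ℝ) ^ 2 := by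
    have h1 : Hm * Aᴴ - Aᴴ * Hm = (A * Hm - Hm * A)ᴴ := by
      rw [conjTranspose_sub, conjTranspose_mul, conjTranspose_mul, hHerm]
    rw [h1, l2_opNorm_conjTranspose]
    exact hnD
  have hexp : (Aᴴ * A) * Hm - Hm * (Aᴴ * A) = Aᴴ * (A * Hm - Hm * A) - (Hm * Aᴴ - Aᴴ * Hm) * A := by
    noncomm_ring
  rw [smul_mul_assoc, mul_smul_comm, ← smul_sub, norm_smul, hexp]
  have hL : (0 : ℝ) < (L : ℝ) := Nat.cast_pos.2 (Nat.pos_of_ne_zero (NeZero.ne L))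
  have hc : ‖(1 : ℂ) / ((L : ℂ) ^ 4)‖ = 1 / (L : ℝ) ^ 4 := by
    rw [norm_div, norm_one, norm_pow, Complex.norm_natCast]
  rw [hc]
  have hL4 : (0 : ℝ) < (L : ℝ) ^ 4 := by positivity
  calc 1 / (L : ℝ) ^ 4 * ‖Aᴴ * (A * Hm - Hm * A) - (Hm * Aᴴ - Aᴴ * Hm) * A‖
      ≤ 1 / (L : ℝ) ^ 4 * (‖Aᴴ‖ * ‖A * Hm - Hm * A‖ + ‖Hm * Aᴴ - Aᴴ * Hm‖ * ‖A‖) :=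
        mul_le_mul_of_nonneg_left
          ((norm_sub_le _ _).trans (add_le_add (norm_mul_le _ _) (norm_mul_le _ _))) (by positivity)
    _ ≤ 1 / (L : ℝ) ^ 4 * ((K * (L : ℝ) ^ 2) * (90 * J * K * (L : ℝ) ^ 2) +
          (90 * J * K * (L : ℝ) ^ 2) * (K * (L : ℝ) ^ 2)) := by
        gcongr
    _ = 180 * K ^ 2 * J := by
        field_simp
        ring

end FirstCommutator

end Summit.HubbardSuperconductivity.HubbardSuperconductivity.Theorems
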